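import Summits.QuantumFields.YangMills.Theorems.BalabanLadderUVSeamRecTorusCeiling
import HarnessLib

/-!
# Crux `UVSeamRec` (stmt-QuantumFields-20043), Tier 2 of the torus thermal ceiling: the Θ(1/β) two-sided pin of the (RM) reference — no log

Helper file (`--supports stmt-QuantumFields-20043`) of the LEAD seat `ym-spine-20043-p1` (gen 11), sequel of `…TorusCeiling`
(`torusE_two_sub_plane_le_of_log_le`: `⟨2 − plane⟩_{2L+1,β} ≤ 29/β` on every odd torus of side `≥ log β`, `β ≥ 2`).

* **`responseMoments_ref_ge_sharp`** — seam-s2's `hRM` binder VERBATIM (the (RM) inequality family at unit `a`, constants `C₁ > 0, B, β₁, ℓ₁`, reference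
  `p`, `SU(2)` fundamental): for `β ≥ β₁`, `β ≥ 2`, `1 ≤ R`, `R·a β ≤ ℓ₁` and every orientation, `2 − 29/β − C₁(e^B − 1)/R⁴ ≤ p q β` (pinning to the
  torus mean — `ResponsePinning.abs_torusE_plane_sub_le_of_responseMoments` — on an admissible odd torus of side `≥ max(4R+8, log β)`);
* **`responseMoments_two_sub_ref_mem_Icc`** — with gen 10's thermal floor (`responseMoments_ref_le`):
  `2 − p q β ∈ [6/(24β+3) − C₁(e^B−1)/R⁴, 29/β + C₁(e^B−1)/R⁴]` — the ∃-reference of the REGISTERED stub `stub_responseMomentsOdd6` IS the perturbative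
  plaquette mean `2 − Θ(1/β)` EXACTLY (gen 11's `responseMoments_ref_mem_Icc` had `8(1 + log β)/β` on the upper side);
* `responseMomentsOdd6SU2_body_ref_pinned_sharp` — the same read on the body of `ResponseMomentsDefs.ResponseMomentsOdd6SU2` (v5(α), afcf556d5b76a240).

HONEST FRAMING: necessary conditions on the ∃-witness of an OPEN registered stub; nothing of E0′, NT or the gap; not Clay.
-/

open MeasureTheory Filter Topology
open Literature.MathematicalPhysics.QuantumLattice (fundamentalLatticeRep LGConfig)
open Summit.QuantumFields.YangMills.Cruxes.OSLegsFromFemtoAndGap.DlrCollarTransfer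
open Summit.QuantumFields.YangMills.Cruxes.UVSeamRec.ResponsePinning (abs_torusE_plane_sub_le_of_responseMoments)

noncomputable section

namespace Summit.QuantumFields.YangMills.Cruxes.UVSeamRec.ClassicalResponse.ThermalFloor

/-! ### The Θ(1/β) lower pin of the (RM) reference -/

section Pinning

/-- A natural number `L ≥ max(4R+8, log β)`: `L := 4R + 8 + ⌈log β⌉₊`. [folklore] -/
private theorem exists_admissible_torus (β : ℝ) (R : ℕ) :
    ∃ L : ℕ, 4 * R + 8 ≤ L ∧ 1 ≤ L ∧ Real.log β ≤ (2 * L + 1 : ℕ) := by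
  refine ⟨4 * R + 8 + ⌈Real.log β⌉₊, by omega, by omega, ?_⟩
  have h1 : Real.log β ≤ ⌈Real.log β⌉₊ := Nat.le_ceil _
  have h2 : ((⌈Real.log β⌉₊ : ℕ) : ℝ) ≤ (2 * (4 * R + 8 + ⌈Real.log β⌉₊) + 1 : ℕ) := by
    exact_mod_cast (by omega : ⌈Real.log β⌉₊ ≤ 2 * (4 * R + 8 + ⌈Real.log β⌉₊) + 1)
  linarith

/-- **(RM) pins its reference value ABOVE `N − Θ(1/β)` — no log.**  Under seam-s2's `hRM` binder VERBATIM (the (RM) inequality family at unit `a`,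
constants `C₁ > 0, B, β₁, ℓ₁`, reference `p`, `SU(2)` fundamental): for `β ≥ β₁`, `β ≥ 2`, `1 ≤ R`, `R·a β ≤ ℓ₁` and every orientation,
`2 − 29/β − C₁(e^B − 1)/R⁴ ≤ p q β` (pinning to the torus mean on an admissible odd torus of side `≥ log β`, plus `torusE_two_sub_plane_le_of_log_le`).
[folklore] -/
theorem responseMoments_ref_ge_sharp (a : ℝ → ℝ) {C₁ B β₁ ℓ₁ : ℝ} {p : Fin 4 × Fin 4 → ℝ → ℝ} (hC₁ : 0 < C₁)
    (hRM : ∀ β : ℝ, β₁ ≤ β → ∀ (L n : ℕ) (q : Fin n → Fin 4 × Fin 4) (x : Fin n → (Fin 4 → ℤ)) (R : ℕ),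
      (∀ i, (q i).1 < (q i).2) → 1 ≤ R → (R : ℝ) * a β ≤ ℓ₁ → 4 * R + 8 ≤ L →
      (∀ i j : Fin n, i ≠ j → ∃ k : Fin 4,
        (2 * (R : ℤ) + 4) ≤ |((((x i k - x j k : ℤ) : ZMod (2 * L + 1))).valMinAbs : ℤ)|) →
      ∀ T : Finset (Fin n),
        torusE (Matrix.specialUnitaryGroup (Fin 2) ℂ) (fundamentalLatticeRep 2) β L
          (fun U => Real.exp (∑ i ∈ T, (R : ℝ) ^ 4 / C₁ *
            |kerE (Matrix.specialUnitaryGroup (Fin 2) ℂ) (fundamentalLatticeRep 2) β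
              (fun k => x i k - (R + 1)) (2 * R + 3) U
              (plane (Matrix.specialUnitaryGroup (Fin 2) ℂ) (fundamentalLatticeRep 2) (q i) (x i)) -
              p (q i) β|)) ≤ Real.exp (B * T.card))
    {β : ℝ} (hβ₁ : β₁ ≤ β) (hβ : 2 ≤ β) {R : ℕ} (hR : 1 ≤ R) (hRa : (R : ℝ) * a β ≤ ℓ₁) (q : Fin 4 × Fin 4) (hq : q.1 < q.2) :
    2 - 29 / β - C₁ * (Real.exp B - 1) / (R : ℝ) ^ 4 ≤ p q β := by
  obtain ⟨L, hL4, hL1, hlog⟩ := exists_admissible_torus β R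
  have h1 := abs_torusE_plane_sub_le_of_responseMoments (fundamentalLatticeRep 2) a hC₁ hRM hβ₁ (L := L) q 0 hq hR hRa hL4
  have h2 := torusE_two_sub_plane_le_of_log_le hβ hL1 hlog q hq 0
  have h3 := (abs_le.1 h1).2
  linarith

/-- **The reference of (RM) is the perturbative plaquette mean `2 − Θ(1/β)`, two-sided, no log**: under seam-s2's `hRM` binder, for `β ≥ β₁`,
`β ≥ 2`, `1 ≤ R`, `R·a β ≤ ℓ₁`, `q.1 < q.2`:
`2 − p q β ∈ [6/(24β+3) − C₁(e^B−1)/R⁴, 29/β + C₁(e^B−1)/R⁴]` (gen 10's `responseMoments_ref_le` and this file's `responseMoments_ref_ge_sharp`).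
[folklore] -/
theorem responseMoments_two_sub_ref_mem_Icc (a : ℝ → ℝ) {C₁ B β₁ ℓ₁ : ℝ} {p : Fin 4 × Fin 4 → ℝ → ℝ} (hC₁ : 0 < C₁)
    (hRM : ∀ β : ℝ, β₁ ≤ β → ∀ (L n : ℕ) (q : Fin n → Fin 4 × Fin 4) (x : Fin n → (Fin 4 → ℤ)) (R : ℕ),
      (∀ i, (q i).1 < (q i).2) → 1 ≤ R → (R : ℝ) * a β ≤ ℓ₁ → 4 * R + 8 ≤ L →
      (∀ i j : Fin n, i ≠ j → ∃ k : Fin 4,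
        (2 * (R : ℤ) + 4) ≤ |((((x i k - x j k : ℤ) : ZMod (2 * L + 1))).valMinAbs : ℤ)|) →
      ∀ T : Finset (Fin n),
        torusE (Matrix.specialUnitaryGroup (Fin 2) ℂ) (fundamentalLatticeRep 2) β L
          (fun U => Real.exp (∑ i ∈ T, (R : ℝ) ^ 4 / C₁ *
            |kerE (Matrix.specialUnitaryGroup (Fin 2) ℂ) (fundamentalLatticeRep 2) β
              (fun k => x i k - (R + 1)) (2 * R + 3) U
              (plane (Matrix.specialUnitaryGroup (Fin 2) ℂ) (fundamentalLatticeRep 2) (q i) (x i)) -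
              p (q i) β|)) ≤ Real.exp (B * T.card))
    {β : ℝ} (hβ₁ : β₁ ≤ β) (hβ : 2 ≤ β) {R : ℕ} (hR : 1 ≤ R) (hRa : (R : ℝ) * a β ≤ ℓ₁) (q : Fin 4 × Fin 4) (hq : q.1 < q.2) :
    2 - p q β ∈ Set.Icc (6 / (24 * β + 3) - C₁ * (Real.exp B - 1) / (R : ℝ) ^ 4) (29 / β + C₁ * (Real.exp B - 1) / (R : ℝ) ^ 4) := by
  have h1 := responseMoments_ref_ge_sharp a hC₁ hRM hβ₁ hβ hR hRa q hq
  have h2 := responseMoments_ref_le a hC₁ hRM hβ₁ (by linarith) hR hRa q hq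
  exact ⟨by linarith, by linarith⟩

end Pinning

/-- **Read on the REGISTERED text, sharp form.**  EVERY witness `(a, c, C₁, B, β₁, ℓ₁, P₀, p)` of the body of `ResponseMomentsDefs.ResponseMomentsOdd6SU2`
(v5(α) stub `stub_responseMomentsOdd6`) has, for `β ≥ β₁`, `β ≥ 2`, `1 ≤ R`, `R·a β ≤ ℓ₁`, `q.1 < q.2`:
`|p q β − 2| ≤ 29/β + C₁(e^B − 1)/R⁴` and `6/(24β+3) − C₁(e^B − 1)/R⁴ ≤ 2 − p q β` — the reference is `2 − Θ(1/β)`. [folklore] -/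
theorem responseMomentsOdd6SU2_body_ref_pinned_sharp (a : ℝ → ℝ) (c C₁ B β₁ ℓ₁ P₀ : ℝ) (p : Fin 4 × Fin 4 → ℝ → ℝ)
    (hbody : 0 < c ∧ (∀ᶠ β in atTop, a β ≤ c * Transport.uRec β) ∧ 0 < ℓ₁ ∧ 0 < C₁ ∧
      (∀ (q : Fin 4 × Fin 4) (β : ℝ), |p q β| ≤ P₀) ∧
      ∀ β : ℝ, β₁ ≤ β → ∀ (L n : ℕ) (q : Fin n → Fin 4 × Fin 4) (x : Fin n → (Fin 4 → ℤ)) (R : ℕ),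
      (∀ i, (q i).1 < (q i).2) → 1 ≤ R → (R : ℝ) * a β ≤ ℓ₁ → 4 * R + 8 ≤ L →
      (∀ i j : Fin n, i ≠ j → ∃ k : Fin 4,
        (2 * (R : ℤ) + 4) ≤ |((((x i k - x j k : ℤ) : ZMod (2 * L + 1))).valMinAbs : ℤ)|) →
      ∀ T : Finset (Fin n),
        torusE (Matrix.specialUnitaryGroup (Fin 2) ℂ) (fundamentalLatticeRep 2) β L
          (fun U => Real.exp (∑ i ∈ T, (R : ℝ) ^ 4 / C₁ *
            |kerE (Matrix.specialUnitaryGroup (Fin 2) ℂ) (fundamentalLatticeRep 2) β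
              (fun k => x i k - (R + 1)) (2 * R + 3) U
              (plane (Matrix.specialUnitaryGroup (Fin 2) ℂ) (fundamentalLatticeRep 2) (q i) (x i)) -
              p (q i) β|)) ≤ Real.exp (B * T.card))
    {β : ℝ} (hβ₁ : β₁ ≤ β) (hβ : 2 ≤ β) {R : ℕ} (hR : 1 ≤ R) (hRa : (R : ℝ) * a β ≤ ℓ₁)
    (q : Fin 4 × Fin 4) (hq : q.1 < q.2) :
    |p q β - 2| ≤ 29 / β + C₁ * (Real.exp B - 1) / (R : ℝ) ^ 4 ∧
      6 / (24 * β + 3) - C₁ * (Real.exp B - 1) / (R : ℝ) ^ 4 ≤ 2 - p q β := by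
  obtain ⟨-, -, -, hC₁, -, hRM⟩ := hbody
  have h := responseMoments_two_sub_ref_mem_Icc a hC₁ hRM hβ₁ hβ hR hRa q hq
  have hβ0 : 0 < β := by linarith
  have hfl : 0 < 6 / (24 * β + 3) := by positivity
  have h29 : 0 ≤ 29 / β := by positivity
  refine ⟨abs_le.2 ⟨by linarith [h.2], by linarith [h.1]⟩, h.1⟩

end Summit.QuantumFields.YangMills.Cruxes.UVSeamRec.ClassicalResponse.ThermalFloor

end
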